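import Mathlib
import HarnessLib
import Summits.HubbardSuperconductivity.HubbardSuperconductivity.Theorems.KLProgrammeKLRegimeTwoVolumeTowerSpineDefs
import Summits.HubbardSuperconductivity.HubbardSuperconductivity.Theorems.KLProgrammeKLRegimeTwoVolumeSourceProfileScale
import Summits.HubbardSuperconductivity.HubbardSuperconductivity.Theorems.KLProgrammeKLRegimeTwoVolumeTowerGenericFacts

/-!
# Route `KLProgramme` — crux K3, VL child `KLRegimeVolumeLimitV17F2` (stmt-HubbardSuperconductivity-20440), blueprint v5 M5: THE SOURCE-TRUNCATED TOWER,
# KIT (located «(VL)-SRC-HIGH», KL STATUS 2026-08-28; seat hubbard-kl-k3c4-p1 g14; `--supports` 20440)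

The (vi) nested two-volume induction (`…TwoVolumeTowerSpine` ff.) runs on the doubled source-carrying states `klTowerState V M β U μ K j` and reads, at
every scale, E1's weighted even profile of `klTowerD V … K j = map (ε•klSrcAnalysisAt … j) 𝒱_{j+1}` over ALL doubled strings
(`…TowerSpineDefs.TowerVolumeData.profile`), i.e. over every number `s` of SOURCE legs (copy `1` = plain position legs).  The producers of record
cover `s = 0` (E1's alive read-out) and `s ∈ {1,2}` (token #24 `SourceProfilesAtLev`); strings with `s ≥ 3` are produced by nobody — and needed by
nobody: the END door reads `srcTrunc 3 (klTowerD … J)` at the source pair, the step covariances `klStepCovD` vanish on sources and the transfers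
`klTowerTransfer` are copy-diagonal.  By the exactness of source grading (Literature `GrassmannSourceGrading`, k3c4-p1 g10) the whole induction may be run
on the SOURCE-TRUNCATED states `srcTrunc 3 (klTowerState …)`.  This file is the kit for that re-threading:

* §1 (generic, `TwoVolumeDefect`): `grassmann_eq_of_kernel_eq`; **`map_toLin'_srcTrunc_comm`** — a copy-diagonal substitution commutes with source
  truncation; **`srcTrunc_effAction_map_srcTrunc`** — `srcTrunc k (effAction C (map T (srcTrunc k X))) = srcTrunc k (effAction C (map T X))` for `C`
  vanishing on sources, `T` copy-diagonal, `constPart X = 0`; `srcCount_residue_eq`, **`norm_keyed_kernel_srcTrunc_le`** / **`KeyedDefectData.srcTrunc`** —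
  keyed two-volume defects only decrease under truncation (block structures preserve copies); `WtProfileEven.srcTrunc`, `WtProfileRaw.srcTrunc`;
* §2 (model, `TwoVolumeSource`): `klStepCovD_eq_zero_of_src`, `klTowerTransfer_copyDiagonal`, **`srcTrunc_klTowerD_eq_map`**
  (`srcTrunc 3 (klTowerD V … K j) = map T_j (srcTrunc 3 (klTowerState V … K j))`), **`srcTrunc_klTowerState_succ`**
  (`srcTrunc 3 (state (j+1)) = srcTrunc 3 (effAction C⁺_j (map T_j (srcTrunc 3 (state j))))`), `srcTrunc_klTowerState_parity`.

Proofs only; no definition; nothing about the model is asserted. [cite: BenfattoGiulianiMastropietro2006, §2.9 (4.3)–(4.6); Salmhofer1999, §4.3 (4.95)]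
-/

noncomputable section

namespace Summit.HubbardSuperconductivity.HubbardSuperconductivity.Theorems.TwoVolumeDefect

set_option linter.dupNamespace false -- summit = problem name (single-conjunct summit), D-0017

open Finset Literature.MathematicalPhysics.QuantumLattice GrassmannAlgebra Literature.Probability.LatticeModels
  Literature.Probability.LatticeModels.BattleFederbush

/-! ## §1 Generic: truncation versus copy-diagonal substitutions, spectator steps, keyed defects and profiles -/

section Generic

variable {𝕜 : Type*} [RCLike 𝕜] {Γ₁ Γ₂ : Type*} [Fintype Γ₁] [DecidableEq Γ₁] [Fintype Γ₂] [DecidableEq Γ₂]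

/-- An element of a finite Grassmann algebra is determined by its kernels. [cite: Salmhofer1999, §4.3 (4.95)] -/
theorem grassmann_eq_of_kernel_eq {F G : GrassmannAlgebra 𝕜 Γ₁} (h : ∀ (m : ℕ) (X : Fin m → Γ₁), kernel 𝕜 F m X = kernel 𝕜 G m X) : F = G := by
  rw [eq_sum_presented_kernel 𝕜 F, eq_sum_presented_kernel 𝕜 G]
  exact sum_congr rfl fun m _ => by rw [show kernel 𝕜 F m = kernel 𝕜 G m from funext (h m)]

/-- **A copy-diagonal substitution commutes with source truncation**: `map T′ (srcTrunc k X) = srcTrunc k (map T′ X)` when `T′ (x,s) (y,t) = 0` for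
`s ≠ t` (the source count of a string is preserved leg by leg). [cite: BenfattoGiulianiMastropietro2006, §2.9 (4.3)-(4.6)] -/
theorem map_toLin'_srcTrunc_comm (T' : Matrix (Γ₂ × Fin 2) (Γ₁ × Fin 2) 𝕜) (hT : ∀ x s y t, s ≠ t → T' (x, s) (y, t) = 0) (k : ℕ)
    (X : GrassmannAlgebra 𝕜 (Γ₁ × Fin 2)) :
    ExteriorAlgebra.map (Matrix.toLin' T') (srcTrunc 𝕜 (fun p : Γ₁ × Fin 2 => p.2 = 1) k X) =
      srcTrunc 𝕜 (fun p : Γ₂ × Fin 2 => p.2 = 1) k (ExteriorAlgebra.map (Matrix.toLin' T') X) := by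
  refine grassmann_eq_of_kernel_eq fun m W' => ?_
  rw [kernel_srcTrunc]
  split_ifs with hlt
  · exact kernel_map_eq_of_kernel_eq_on_srcCount T' hT _ _ W' fun W hW => by
      rw [kernel_srcTrunc, if_pos (by rw [hW]; exact hlt)]
  · have h0 : kernel 𝕜 (ExteriorAlgebra.map (Matrix.toLin' T') (srcTrunc 𝕜 (fun p : Γ₁ × Fin 2 => p.2 = 1) k X)) m W' =
        kernel 𝕜 (ExteriorAlgebra.map (Matrix.toLin' T') 0) m W' :=
      kernel_map_eq_of_kernel_eq_on_srcCount T' hT _ _ W' fun W hW => by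
        rw [kernel_srcTrunc, if_neg (by rw [hW]; exact hlt), kernel_zero_right]
    rw [h0, map_zero, kernel_zero_right]

/-- **A spectator single-scale step after a copy-diagonal substitution may be run on the truncated input**:
`srcTrunc k (effAction C (map T′ (srcTrunc k X))) = srcTrunc k (effAction C (map T′ X))` for a covariance `C` vanishing on the sources, `T′`
copy-diagonal and `X` without constant part. [cite: BenfattoGiulianiMastropietro2006, §2.9 (4.3)-(4.6)] -/
theorem srcTrunc_effAction_map_srcTrunc (C : Matrix (Γ₂ × Fin 2) (Γ₂ × Fin 2) 𝕜)
    (hC : ∀ X Y : Γ₂ × Fin 2, X.2 = 1 ∨ Y.2 = 1 → C X Y = 0)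
    (T' : Matrix (Γ₂ × Fin 2) (Γ₁ × Fin 2) 𝕜) (hT : ∀ x s y t, s ≠ t → T' (x, s) (y, t) = 0) (k : ℕ)
    {X : GrassmannAlgebra 𝕜 (Γ₁ × Fin 2)} (hX : constPart 𝕜 X = 0) :
    srcTrunc 𝕜 (fun p : Γ₂ × Fin 2 => p.2 = 1) k (effAction 𝕜 C (ExteriorAlgebra.map (Matrix.toLin' T') (srcTrunc 𝕜 (fun p : Γ₁ × Fin 2 => p.2 = 1) k X))) =
      srcTrunc 𝕜 (fun p : Γ₂ × Fin 2 => p.2 = 1) k (effAction 𝕜 C (ExteriorAlgebra.map (Matrix.toLin' T') X)) := by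
  rw [map_toLin'_srcTrunc_comm T' hT k X]
  exact srcTrunc_effAction_srcTrunc 𝕜 (fun p : Γ₂ × Fin 2 => p.2 = 1) C hC k (by rw [constPart_map]; exact hX)

omit [Fintype Γ₁] [DecidableEq Γ₁] [Fintype Γ₂] [DecidableEq Γ₂] in
/-- **The residue string of a doubled block structure has the same source count** (the block structure keeps the copy). [folklore] -/
theorem srcCount_residue_eq {Bk : Type*} (ed₁ : (Γ₂ × Fin 2) ≃ Bk × (Γ₁ × Fin 2)) (hcopy : ∀ y : Γ₂ × Fin 2, ((ed₁ y).2).2 = y.2)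
    {k : ℕ} (Y' : Fin k → Γ₂ × Fin 2) :
    srcCount (fun p : Γ₁ × Fin 2 => p.2 = 1) (fun i => (ed₁ (Y' i)).2) = srcCount (fun p : Γ₂ × Fin 2 => p.2 = 1) Y' := by
  unfold srcCount
  congr 1
  ext i
  simp [hcopy]

/-- **Keyed two-volume defects only decrease under source truncation** (termwise): the fine string and its residue string are truncated on the same
condition. [cite: BenfattoGiulianiMastropietro2006, §2.9 (4.3)-(4.6)] -/
theorem norm_keyed_kernel_srcTrunc_le {Bk : Type*} [DecidableEq Bk] (ed₁ : (Γ₂ × Fin 2) ≃ Bk × (Γ₁ × Fin 2)) (hcopy : ∀ y : Γ₂ × Fin 2, ((ed₁ y).2).2 = y.2)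
    (A' : GrassmannAlgebra 𝕜 (Γ₂ × Fin 2)) (A : GrassmannAlgebra 𝕜 (Γ₁ × Fin 2)) (kk : ℕ) {k : ℕ} (Y' : Fin k → Γ₂ × Fin 2) (p : Fin k) :
    ‖kernel 𝕜 (srcTrunc 𝕜 (fun q : Γ₂ × Fin 2 => q.2 = 1) kk A') k Y' -
        (if ∀ i, (ed₁ (Y' i)).1 = (ed₁ (Y' p)).1 then kernel 𝕜 (srcTrunc 𝕜 (fun q : Γ₁ × Fin 2 => q.2 = 1) kk A) k (fun i => (ed₁ (Y' i)).2) else 0)‖ ≤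
      ‖kernel 𝕜 A' k Y' - (if ∀ i, (ed₁ (Y' i)).1 = (ed₁ (Y' p)).1 then kernel 𝕜 A k (fun i => (ed₁ (Y' i)).2) else 0)‖ := by
  rw [kernel_srcTrunc, kernel_srcTrunc, srcCount_residue_eq ed₁ hcopy]
  by_cases hlt : srcCount (fun q : Γ₂ × Fin 2 => q.2 = 1) Y' < kk
  · simp only [hlt, if_true]; exact le_rfl
  · simp only [hlt, if_false, ite_self, sub_zero, norm_zero]; exact norm_nonneg _

/-- **Summed form**: the pinned keyed defect of the truncations is at most that of the originals. [cite: BenfattoGiulianiMastropietro2006, §2.9 (4.3)-(4.6)] -/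
theorem sum_filter_norm_keyed_kernel_srcTrunc_le {Bk : Type*} [DecidableEq Bk] (ed₁ : (Γ₂ × Fin 2) ≃ Bk × (Γ₁ × Fin 2)) (hcopy : ∀ y : Γ₂ × Fin 2, ((ed₁ y).2).2 = y.2)
    (A' : GrassmannAlgebra 𝕜 (Γ₂ × Fin 2)) (A : GrassmannAlgebra 𝕜 (Γ₁ × Fin 2)) (kk : ℕ) (k : ℕ) (p : Fin k) (y' : Γ₂ × Fin 2) :
    ∑ Y' ∈ univ.filter (fun Y' : Fin k → Γ₂ × Fin 2 => Y' p = y'),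
        ‖kernel 𝕜 (srcTrunc 𝕜 (fun q : Γ₂ × Fin 2 => q.2 = 1) kk A') k Y' -
          (if ∀ i, (ed₁ (Y' i)).1 = (ed₁ (Y' p)).1 then kernel 𝕜 (srcTrunc 𝕜 (fun q : Γ₁ × Fin 2 => q.2 = 1) kk A) k (fun i => (ed₁ (Y' i)).2) else 0)‖ ≤
      ∑ Y' ∈ univ.filter (fun Y' : Fin k → Γ₂ × Fin 2 => Y' p = y'),
        ‖kernel 𝕜 A' k Y' - (if ∀ i, (ed₁ (Y' i)).1 = (ed₁ (Y' p)).1 then kernel 𝕜 A k (fun i => (ed₁ (Y' i)).2) else 0)‖ :=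
  sum_le_sum fun Y' _ => norm_keyed_kernel_srcTrunc_le ed₁ hcopy A' A kk Y' p

end Generic

section Bundles

variable {b L Lf M N₁ : ℕ} [NeZero L] [NeZero Lf]

/-- **`KeyedDefectData` passes to the source truncations** (any truncation degree `kk`), for a doubled block structure keeping the copy.
[cite: BenfattoGiulianiMastropietro2006, §2.9 (4.3)-(4.6)] -/
theorem KeyedDefectData.srcTrunc
    {ed₁ : ((SpaceTimeIdx Lf M × SectorLeg N₁) × Fin 2) ≃ (Fin 2 → Fin b) × ((SpaceTimeIdx L M × SectorLeg N₁) × Fin 2)}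
    (hcopy : ∀ y, ((ed₁ y).2).2 = y.2)
    {𝒲' : GrassmannAlgebra ℂ ((SpaceTimeIdx Lf M × SectorLeg N₁) × Fin 2)} {𝒲 : GrassmannAlgebra ℂ ((SpaceTimeIdx L M × SectorLeg N₁) × Fin 2)}
    {N R RF : ℕ} {Ej NDj : ℕ → ℝ} (hD : KeyedDefectData (N := N) ed₁ 𝒲' 𝒲 R RF Ej NDj) (kk : ℕ) :
    KeyedDefectData (N := N) ed₁ (srcTrunc ℂ (fun q : (SpaceTimeIdx Lf M × SectorLeg N₁) × Fin 2 => q.2 = 1) kk 𝒲')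
      (srcTrunc ℂ (fun q : (SpaceTimeIdx L M × SectorLeg N₁) × Fin 2 => q.2 = 1) kk 𝒲) R RF Ej NDj where
  Ej_nonneg := hD.Ej_nonneg
  NDj_nonneg := hD.NDj_nonneg
  deep x hx k p y' hy' := (sum_filter_norm_keyed_kernel_srcTrunc_le ed₁ hcopy 𝒲' 𝒲 kk k p y').trans (hD.deep x hx k p y' hy')
  everywhere k p y' := (sum_filter_norm_keyed_kernel_srcTrunc_le ed₁ hcopy 𝒲' 𝒲 kk k p y').trans (hD.everywhere k p y')

variable {V Ns : ℕ} [NeZero V]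

/-- **Even weighted profiles pass to the source truncations.** [cite: Salmhofer1999, §4.3 (4.95)] -/
theorem WtProfileEven.srcTrunc {W : GrassmannAlgebra ℂ ((SpaceTimeIdx V M × SectorLeg Ns) × Fin 2)} {Λ : ℝ} {N : ℕ → ℝ}
    (hW : WtProfileEven W Λ N) (kk : ℕ) :
    WtProfileEven (srcTrunc ℂ (fun q : (SpaceTimeIdx V M × SectorLeg Ns) × Fin 2 => q.2 = 1) kk W) Λ N where
  nonneg := hW.nonneg
  le m' j x := (sum_filter_norm_kernel_srcTrunc_mul_le (fun q : (SpaceTimeIdx V M × SectorLeg Ns) × Fin 2 => q.2 = 1) kk W (2 * m') j x _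
    (fun _ => add_nonneg zero_le_one (labelDiam_nonneg _ _))).trans (hW.le m' j x)

/-- **Raw weighted profiles pass to the source truncations.** [cite: Salmhofer1999, §4.3 (4.95)] -/
theorem WtProfileRaw.srcTrunc {W : GrassmannAlgebra ℂ ((SpaceTimeIdx V M × SectorLeg Ns) × Fin 2)} {Λ : ℝ} {N : ℕ → ℝ}
    (hW : WtProfileRaw W Λ N) (kk : ℕ) :
    WtProfileRaw (srcTrunc ℂ (fun q : (SpaceTimeIdx V M × SectorLeg Ns) × Fin 2 => q.2 = 1) kk W) Λ N where
  nonneg := hW.nonneg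
  le k p y := (sum_filter_norm_kernel_srcTrunc_mul_le (fun q : (SpaceTimeIdx V M × SectorLeg Ns) × Fin 2 => q.2 = 1) kk W k p y _
    (fun _ => add_nonneg zero_le_one (labelDiam_nonneg _ _))).trans (hW.le k p y)

end Bundles

end Summit.HubbardSuperconductivity.HubbardSuperconductivity.Theorems.TwoVolumeDefect

namespace Summit.HubbardSuperconductivity.HubbardSuperconductivity.Theorems.TwoVolumeSource

set_option linter.dupNamespace false -- summit = problem name (single-conjunct summit), D-0017

open Finset Literature.MathematicalPhysics.QuantumLattice GrassmannAlgebra Literature.Probability.LatticeModels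
open Summit.HubbardSuperconductivity.HubbardSuperconductivity.Theorems.KLProgrammeLegKernels
open Summit.HubbardSuperconductivity.HubbardSuperconductivity.Theorems.KLRegimeSplit
open Summit.HubbardSuperconductivity.HubbardSuperconductivity.Theorems.EngineV8
open Summit.HubbardSuperconductivity.HubbardSuperconductivity.Theorems.TwoVolumeDefect

/-! ## §2 The model's tower: the source-truncated states obey the same recursion -/

section Model

variable {V M : ℕ} [NeZero V] [NeZero M]

omit [NeZero M] in
/-- **The spectator lift of the step covariance vanishes on the sources.** [folklore] -/
theorem klStepCovD_eq_zero_of_src (β μ : ℝ) (K : TrigPolyC4v) (k : ℕ) (p q : SrcLabel V M k) (h : p.2 = 1 ∨ q.2 = 1) :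
    klStepCovD V M β μ K k p q = 0 := by
  rw [klStepCovD_apply]
  rcases h with h | h
  · rw [if_neg (by rw [h]; simp)]
  · rw [if_neg (by rw [h]; simp)]

omit [NeZero M] in
/-- **The transfers of the tower are copy-diagonal.** [folklore] -/
theorem klTowerTransfer_copyDiagonal (β μ : ℝ) (K : TrigPolyC4v) (j : ℕ) :
    ∀ (x : SpaceTimeIdx V M × SectorLeg (sectorCount j)) (s : Fin 2) (y : SpaceTimeIdx V M × SectorLeg (sectorCount (j - 1))) (t : Fin 2),
      s ≠ t → klTowerTransfer V M β μ K j (x, s) (y, t) = 0 := by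
  intro x s y t hst
  cases j with
  | zero =>
    rw [klTowerTransfer_zero, Matrix.one_apply, if_neg]
    exact fun h => hst (congrArg Prod.snd h)
  | succ k =>
    rw [klTowerTransfer_succ, klSrcTransfer_apply]
    have h0 : ¬ (s = 0 ∧ t = 0) := fun h => hst (h.1.trans h.2.symm)
    have h1 : ¬ (s = 1 ∧ t = 1) := fun h => hst (h.1.trans h.2.symm)
    simp only [h0, h1, if_false]

/-- **`srcTrunc 3 (klTowerD V … K j) = map T_j (srcTrunc 3 (klTowerState V … K j))`** (given the partition functions of the integrated scales): the
object of E1's alive read-out ⊕ token #24 IS the re-analysed truncated state. [cite: BenfattoGiulianiMastropietro2006, §2.7 (2.70)-(2.71), §2.9 (4.3)-(4.6)] -/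
theorem srcTrunc_klTowerD_eq_map {β : ℝ} (hβ : β ≠ 0) (U μ : ℝ) (K : TrigPolyC4v) (j : ℕ) (kk : ℕ)
    (hZ : ∀ k, j = k + 1 → hubbardEffPartitionFnCT V M β U μ 0 K (klScale klE0 (k + 1)) ≠ 0) :
    srcTrunc ℂ (fun q : SrcLabel V M j => q.2 = 1) kk (klTowerD V M β U μ K j) =
      ExteriorAlgebra.map (Matrix.toLin' (klTowerTransfer V M β μ K j))
        (srcTrunc ℂ (fun q : SrcLabel V M (j - 1) => q.2 = 1) kk (klTowerState V M β U μ K j)) := by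
  rw [map_toLin'_srcTrunc_comm _ (klTowerTransfer_copyDiagonal β μ K j) kk, map_klTowerTransfer_klTowerState hβ U μ K j hZ]

/-- **The truncated states obey the tower's recursion**: `srcTrunc 3 (state (j+1)) = srcTrunc 3 (effAction C⁺_j (map T_j (srcTrunc 3 (state j))))`
(given the partition functions of the integrated scales, which make `klTowerD … j` constant-free). [cite: BenfattoGiulianiMastropietro2006, §2.9 (4.3)-(4.6)] -/
theorem srcTrunc_klTowerState_succ {β : ℝ} (hβ : β ≠ 0) (U μ : ℝ) (K : TrigPolyC4v) (j : ℕ) (kk : ℕ)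
    (hZ : ∀ k, j = k + 1 → hubbardEffPartitionFnCT V M β U μ 0 K (klScale klE0 (k + 1)) ≠ 0)
    (hZj : hubbardEffPartitionFnCT V M β U μ 0 K (klScale klE0 (j + 1)) ≠ 0) :
    srcTrunc ℂ (fun q : SrcLabel V M j => q.2 = 1) kk (klTowerState V M β U μ K (j + 1)) =
      srcTrunc ℂ (fun q : SrcLabel V M j => q.2 = 1) kk (effAction ℂ (klStepCovD V M β μ K j)
        (ExteriorAlgebra.map (Matrix.toLin' (klTowerTransfer V M β μ K j))
          (srcTrunc ℂ (fun q : SrcLabel V M (j - 1) => q.2 = 1) kk (klTowerState V M β U μ K j)))) := by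
  have h0 : constPart ℂ (klTowerState V M β U μ K j) = 0 := by
    have hD := (klTowerD_parity β U μ K j hZj).2
    rw [← map_klTowerTransfer_klTowerState hβ U μ K j hZ, constPart_map] at hD
    exact hD
  rw [klTowerState_succ_eq_effAction_map hβ U μ K j hZ]
  exact (srcTrunc_effAction_map_srcTrunc (klStepCovD V M β μ K j) (klStepCovD_eq_zero_of_src β μ K j) _
    (klTowerTransfer_copyDiagonal β μ K j) kk h0).symm

/-- **Parity of the truncated read-outs**: `srcTrunc 3 (klTowerD V … K j)` is even without constant part (given `Z^K_{Λ_{j+1}} ≠ 0`). [folklore] -/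
theorem srcTrunc_klTowerD_parity (β U μ : ℝ) (K : TrigPolyC4v) (j kk : ℕ)
    (hZ : hubbardEffPartitionFnCT V M β U μ 0 K (klScale klE0 (j + 1)) ≠ 0) :
    srcTrunc ℂ (fun q : SrcLabel V M j => q.2 = 1) kk (klTowerD V M β U μ K j) ∈ evenOdd ℂ 0 ∧
      constPart ℂ (srcTrunc ℂ (fun q : SrcLabel V M j => q.2 = 1) kk (klTowerD V M β U μ K j)) = 0 := by
  obtain ⟨he, h0⟩ := klTowerD_parity β U μ K j hZ
  exact ⟨(mem_evenPart_iff).1 (srcTrunc_mem_evenPart ℂ _ kk ((mem_evenPart_iff).2 he)), constPart_srcTrunc_eq_zero ℂ _ kk h0⟩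

end Model

end Summit.HubbardSuperconductivity.HubbardSuperconductivity.Theorems.TwoVolumeSource

end
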